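import Summits.RiemannHypothesis.RiemannHypothesis.Theses.ScrewMultisection
import Summits.RiemannHypothesis.RiemannHypothesis.Theorems.Splittings.ScrewMultisectionBridge
import Summits.RiemannHypothesis.RiemannHypothesis.Theorems.ScrewMultisectionAssembly
import Summits.RiemannHypothesis.RiemannHypothesis.Theorems.Splittings.ScrewLatticeThinWall
import Literature.NumberTheory.LFunctions.ZetaScrewThm17Proofs
import HarnessLib

/-!
# Row X-17 — `PeriodicSignsRaysFree ∧ ThinWallOne ⟺ RH` (route ScrewMultisection, UNCONDITIONAL row)

Cell rh-split, RULING #328 (b) (lead g9): both legs of the bridge row are CLOSED in the tree —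
`Theses.ScrewMultisection.MultisectionBridge` by `Splittings.ScrewLatticeMultisection.multisectionBridge_proof`
(item 23144) and `Theses.ScrewMultisection.Assembly` by `Theorems.ScrewMultisection.assembly_proof` (item 23146) — so
the row needs NO named fact: `(PeriodicSignsRaysFree ∧ ThinWallOne) → RH` is `assembly_proof multisectionBridge_proof`,
and the converses `RH → PeriodicSignsRaysFree` (period `q = 1`: under RH `Ψ ≥ 0` has no negative sample at all and the
aliased pole field is empty) and `RH → ThinWallOne` (`ScrewLatticeThinWall.thinWall_of_rh`) are the planner's
(rh-idea-1 g0, `pub/ideators/rh-idea-1/multisection/Sketch6.lean` sha16 e0fef3a4a34490aa, `periodicSignsRaysFree_of_rh`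
/ `thinWallOne_of_rh`, ll.54–64) written against the route decls. Standard axioms. Supports item
stmt-RiemannHypothesis-23145 (`PeriodicSignsRaysFree`, the open conjunct) without closing it.

HONEST LABEL: «SPLITTING SEARCH over kernel-typed RH-EQUIVALENCES; a splitting A ∧ B ⟹ RH is CONDITIONAL bookkeeping
unless A and B are both proved; nothing here bears on the truth of RH.»
-/

-- D-0017: `Summit.RiemannHypothesis.RiemannHypothesis.…` duplicates the namespace BY DESIGN (single-problem summit).
set_option linter.dupNamespace false

namespace Summit.RiemannHypothesis.RiemannHypothesis.Theorems.Splittings.ScrewMultisectionRow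

open Literature.NumberTheory.LFunctions
open Summit.RiemannHypothesis.RiemannHypothesis.Theses.ScrewMultisection (MultisectionBridge PeriodicSignsRaysFree
  ThinWallOne Assembly)
open Summit.RiemannHypothesis.RiemannHypothesis.Theorems.Splittings.ScrewLatticeContinuation (aliasedPoleSet
  aliasedPoleSet_eq_empty_of_rh)
open Summit.RiemannHypothesis.RiemannHypothesis.Theorems.Splittings.ScrewLatticeThinWall (ThinWall thinWall_of_rh)

/-- **RH ⟹ `PeriodicSignsRaysFree`** with period `q = 1`: under RH Suzuki's screw function is nonnegative
(`ZetaScrewThm17.zetaScrew_nonneg_of_RH`), so the sign pattern of `Ψ(k)` is (trivially) eventually `1`-periodic, and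
the aliased pole field `aliasedPoleSet 1` is empty (`aliasedPoleSet_eq_empty_of_rh`), so its closure misses every ray.
(rh-idea-1 Sketch6 `periodicSignsRaysFree_of_rh`, e0fef3a4.) -/
theorem periodicSignsRaysFree_of_rh (hRH : RiemannHypothesis) : PeriodicSignsRaysFree := by
  unfold Summit.RiemannHypothesis.RiemannHypothesis.Theses.ScrewMultisection.PeriodicSignsRaysFree
  refine ⟨1, one_pos, ⟨0, fun k _ ↦ ?_⟩, fun j t _ _ ↦ ?_⟩
  · have h1 := ZetaScrewThm17.zetaScrew_nonneg_of_RH hRH (k * (1 : ℝ))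
    have h2 := ZetaScrewThm17.zetaScrew_nonneg_of_RH hRH ((k + 1 : ℕ) * (1 : ℝ))
    push_cast at h2 ⊢
    constructor <;> intro h <;> linarith
  · rw [aliasedPoleSet_eq_empty_of_rh hRH, closure_empty]
    simp

/-- **RH ⟹ `ThinWallOne`** (`TW(1)`), by name from row X-10's `ScrewLatticeThinWall.thinWall_of_rh`.
(rh-idea-1 Sketch6 `thinWallOne_of_rh`.) -/
theorem thinWallOne_of_rh (hRH : RiemannHypothesis) : ThinWallOne :=
  thinWall_of_rh hRH 1

/-- **`PeriodicSignsRaysFree ⟹ ThinWallOne ⟹ RH`**, UNCONDITIONAL: the route's `Assembly`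
(`Theorems.ScrewMultisection.assembly_proof`, item 23146) fed with the PROVED bridge
`Splittings.ScrewLatticeMultisection.multisectionBridge_proof` (item 23144). -/
theorem rh_of_periodicSignsRaysFree_of_thinWallOne (h₂ : PeriodicSignsRaysFree) (h₃ : ThinWallOne) :
    RiemannHypothesis :=
  ScrewMultisection.assembly_proof ScrewLatticeMultisection.multisectionBridge_proof h₂ h₃

/-- **ROW X-17 (the splitting, unconditional — the bridge is a theorem, no fact)**:
`(PeriodicSignsRaysFree ∧ ThinWallOne) ↔ RiemannHypothesis` (shape of row X-11
`ScrewDustWallRow.latticeCeiling_and_dustWall_iff_rh`). Conditional bookkeeping value only: both conjuncts are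
RH-implied open statements; nothing here bears on the truth of RH. -/
theorem periodicSignsRaysFree_and_thinWallOne_iff_rh :
    (PeriodicSignsRaysFree ∧ ThinWallOne) ↔ RiemannHypothesis :=
  ⟨fun hab ↦ rh_of_periodicSignsRaysFree_of_thinWallOne hab.1 hab.2,
    fun hRH ↦ ⟨periodicSignsRaysFree_of_rh hRH, thinWallOne_of_rh hRH⟩⟩

end Summit.RiemannHypothesis.RiemannHypothesis.Theorems.Splittings.ScrewMultisectionRow
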